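import Mathlib
import Summits.KontsevichZagierPeriods.KontsevichZagierPeriods.Theses.SymplecticScissors
import Summits.KontsevichZagierPeriods.KontsevichZagierPeriods.Theorems.SymplecticScissorsVolumeFormOddBallCylinder
import Summits.KontsevichZagierPeriods.KontsevichZagierPeriods.Theorems.SymplecticScissorsVolumeFormPerspectiveMap
import Literature.NumberTheory.Transcendental.KZCalculusProofs
import Literature.NumberTheory.Transcendental.SemialgebraicMapsProofs
import Literature.NumberTheory.Transcendental.KZSemialgebraicComplex

/-!
# `VolumeForm` (stmt-KontsevichZagierPeriods-3814), line `Sketch` — stub `stub_oddBallEven`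

The calibration family "odd balls are cylinders over even balls" in every odd dimension
`N + 1 = 2m + 3`: for representations `r` on the open unit ball of `ℝ^{N+1}` and `r'` on the
cylinder `B^N × (−P 1, P 1)`, both with integrand `1` on their domains, `[r] − [r']` is ONE
change-of-variables generator (`KZ.changeOfVariablesRel`, rule (2) of
[Kontsevich–Zagier 2001, §1.2]). Here
`P z = ∑_{j ≤ m+1} (−1)^j C(m+1, j) z^(2j+1) / (2j+1) = ∫₀ᶻ (1 − s²)^(m+1) ds` and the witness is
`Φ p = (p' / √(1 − z²), P z)`, `z = p_N`, `p' = (p_0, …, p_{N−1})`. Its Jacobian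
`Φ' p = pi (snoc (fun i => s⁻¹ • proj i + (p_i z / s³) • proj N) ((1 − z²)^(m+1) • proj N))`,
`s = √(1 − z²)`, is literally the perspective Jacobian of `stub_perspectiveMap` at the auxiliary
point `(−p' z / s, s)` (corner entry `s ^ N = (1 − z²)^(m+1)` as `N = 2m + 2`), so `det Φ' = 1` by
`persp_det_eq_one`. The five fields: `Φ` is `ℚ`-semialgebraic (quotients by the square root of a
polynomial, a polynomial), differentiable on the ball, injective (`P' = (1 − z²)^(m+1) > 0` on
`(−1, 1)`), onto the cylinder (intermediate value theorem for `P`, explicit inverse `(q' s, z)`),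
and `1 = 1 · |1|`. The case `m = 0` is `stub_oddBallCylinder`.

Sources: M. Kontsevich, D. Zagier, *Periods* (2001), §1.2 rule (2); the rest is folklore calculus
(Archimedes' hat-box theorem in higher dimension).
-/

noncomputable section

open scoped BigOperators
open Set MeasureTheory MvPolynomial
open Literature.NumberTheory.Transcendental

namespace Summit.KontsevichZagierPeriods.SymplecticScissors.VolumeForm

/-- The odd polynomial `P z = ∑_{j ≤ m + 1} (−1)^j C(m + 1, j) z^(2j+1) / (2j + 1)` (the primitive
of `(1 − z²)^(m+1)` vanishing at `0`) has derivative `(1 − z²)^(m+1)` (binomial theorem).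
[folklore] -/
theorem oddEven_hasDerivAt_prim (m : ℕ) (z : ℝ) :
    HasDerivAt (fun z : ℝ => ∑ j ∈ Finset.range (m + 2),
        (-1 : ℝ) ^ j * (Nat.choose (m + 1) j : ℝ) / (2 * j + 1) * z ^ (2 * j + 1))
      ((1 - z ^ 2) ^ (m + 1)) z := by
  have h := HasDerivAt.fun_sum (u := Finset.range (m + 2)) (x := z)
    fun j _ => (hasDerivAt_pow (2 * j + 1) z).const_mul
      ((-1 : ℝ) ^ j * (Nat.choose (m + 1) j : ℝ) / (2 * j + 1))
  refine h.congr_deriv ?_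
  rw [sub_eq_neg_add, add_pow]
  refine Finset.sum_congr rfl fun j _ => ?_
  have hj : (2 * (j : ℝ) + 1) ≠ 0 := by positivity
  rw [one_pow, mul_one, neg_pow (z ^ 2), ← pow_mul, Nat.add_sub_cancel]
  push_cast
  field_simp

/-- `P` is odd: `P (−z) = −P z`. [folklore] -/
theorem oddEven_prim_neg (m : ℕ) (z : ℝ) :
    ∑ j ∈ Finset.range (m + 2),
        (-1 : ℝ) ^ j * (Nat.choose (m + 1) j : ℝ) / (2 * j + 1) * (-z) ^ (2 * j + 1) =
      -∑ j ∈ Finset.range (m + 2),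
        (-1 : ℝ) ^ j * (Nat.choose (m + 1) j : ℝ) / (2 * j + 1) * z ^ (2 * j + 1) := by
  rw [← Finset.sum_neg_distrib]
  refine Finset.sum_congr rfl fun j _ => ?_
  rw [Odd.neg_pow (odd_two_mul_add_one j), mul_neg]

/-- `P` is strictly increasing on `[−1, 1]` (its derivative `(1 − z²)^(m+1)` is positive on the
interior). [folklore] -/
theorem oddEven_prim_lt (m : ℕ) {y z : ℝ} (hy : -1 ≤ y) (hz : z ≤ 1) (hyz : y < z) :
    ∑ j ∈ Finset.range (m + 2),
        (-1 : ℝ) ^ j * (Nat.choose (m + 1) j : ℝ) / (2 * j + 1) * y ^ (2 * j + 1) <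
      ∑ j ∈ Finset.range (m + 2),
        (-1 : ℝ) ^ j * (Nat.choose (m + 1) j : ℝ) / (2 * j + 1) * z ^ (2 * j + 1) := by
  have hmono : StrictMonoOn (fun z : ℝ => ∑ j ∈ Finset.range (m + 2),
      (-1 : ℝ) ^ j * (Nat.choose (m + 1) j : ℝ) / (2 * j + 1) * z ^ (2 * j + 1)) (Icc (-1) 1) := by
    refine strictMonoOn_of_deriv_pos (convex_Icc (-1) 1)
      (fun x _ => (oddEven_hasDerivAt_prim m x).continuousAt.continuousWithinAt) fun x hx => ?_
    rw [interior_Icc] at hx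
    rw [(oddEven_hasDerivAt_prim m x).deriv]
    have hx2 : 0 < 1 - x ^ 2 := by nlinarith [hx.1, hx.2]
    positivity
  exact hmono ⟨hy, hyz.le.trans hz⟩ ⟨hy.trans hyz.le, hz⟩ hyz

/-- `P` maps `(−1, 1)` into `(−P 1, P 1)`. [folklore] -/
theorem oddEven_prim_abs_lt (m : ℕ) {z : ℝ} (hz : z ^ 2 < 1) :
    |∑ j ∈ Finset.range (m + 2),
        (-1 : ℝ) ^ j * (Nat.choose (m + 1) j : ℝ) / (2 * j + 1) * z ^ (2 * j + 1)| <
      ∑ j ∈ Finset.range (m + 2), (-1 : ℝ) ^ j * (Nat.choose (m + 1) j : ℝ) / (2 * j + 1) := by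
  obtain ⟨hz1, hz2⟩ := abs_lt.1 ((sq_lt_one_iff_abs_lt_one z).1 hz)
  have hone : ∑ j ∈ Finset.range (m + 2),
      (-1 : ℝ) ^ j * (Nat.choose (m + 1) j : ℝ) / (2 * j + 1) * (1 : ℝ) ^ (2 * j + 1) =
      ∑ j ∈ Finset.range (m + 2), (-1 : ℝ) ^ j * (Nat.choose (m + 1) j : ℝ) / (2 * j + 1) := by
    simp only [one_pow, mul_one]
  have h1 := oddEven_prim_lt m hz1.le le_rfl hz2
  have h2 := oddEven_prim_lt m le_rfl hz2.le hz1
  rw [oddEven_prim_neg, hone] at h2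
  rw [hone] at h1
  exact abs_lt.2 ⟨h2, h1⟩

/-- `P` is injective on `(−1, 1)`. [folklore] -/
theorem oddEven_prim_inj (m : ℕ) {y z : ℝ} (hy : y ^ 2 < 1) (hz : z ^ 2 < 1)
    (h : ∑ j ∈ Finset.range (m + 2),
        (-1 : ℝ) ^ j * (Nat.choose (m + 1) j : ℝ) / (2 * j + 1) * y ^ (2 * j + 1) =
      ∑ j ∈ Finset.range (m + 2),
        (-1 : ℝ) ^ j * (Nat.choose (m + 1) j : ℝ) / (2 * j + 1) * z ^ (2 * j + 1)) : y = z := by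
  obtain ⟨hy1, hy2⟩ := abs_lt.1 ((sq_lt_one_iff_abs_lt_one y).1 hy)
  obtain ⟨hz1, hz2⟩ := abs_lt.1 ((sq_lt_one_iff_abs_lt_one z).1 hz)
  rcases lt_trichotomy y z with hlt | heq | hgt
  · exact absurd h (oddEven_prim_lt m hy1.le hz2.le hlt).ne
  · exact heq
  · exact absurd h (oddEven_prim_lt m hz1.le hy2.le hgt).ne'

/-- `P` maps `(−1, 1)` onto `(−P 1, P 1)` (intermediate value theorem). [folklore] -/
theorem oddEven_prim_surj (m : ℕ) {w : ℝ}
    (hw : |w| < ∑ j ∈ Finset.range (m + 2), (-1 : ℝ) ^ j * (Nat.choose (m + 1) j : ℝ) / (2 * j + 1)) :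
    ∃ z : ℝ, z ^ 2 < 1 ∧ ∑ j ∈ Finset.range (m + 2),
      (-1 : ℝ) ^ j * (Nat.choose (m + 1) j : ℝ) / (2 * j + 1) * z ^ (2 * j + 1) = w := by
  obtain ⟨hw1, hw2⟩ := abs_lt.1 hw
  have hcont : ContinuousOn (fun z : ℝ => ∑ j ∈ Finset.range (m + 2),
      (-1 : ℝ) ^ j * (Nat.choose (m + 1) j : ℝ) / (2 * j + 1) * z ^ (2 * j + 1)) (Icc (-1) 1) :=
    fun x _ => (oddEven_hasDerivAt_prim m x).continuousAt.continuousWithinAt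
  have hone : ∑ j ∈ Finset.range (m + 2),
      (-1 : ℝ) ^ j * (Nat.choose (m + 1) j : ℝ) / (2 * j + 1) * (1 : ℝ) ^ (2 * j + 1) =
      ∑ j ∈ Finset.range (m + 2), (-1 : ℝ) ^ j * (Nat.choose (m + 1) j : ℝ) / (2 * j + 1) := by
    simp only [one_pow, mul_one]
  have hneg := oddEven_prim_neg m 1
  rw [hone] at hneg
  have hmem : w ∈ Icc
      ((fun z : ℝ => ∑ j ∈ Finset.range (m + 2),
        (-1 : ℝ) ^ j * (Nat.choose (m + 1) j : ℝ) / (2 * j + 1) * z ^ (2 * j + 1)) (-1))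
      ((fun z : ℝ => ∑ j ∈ Finset.range (m + 2),
        (-1 : ℝ) ^ j * (Nat.choose (m + 1) j : ℝ) / (2 * j + 1) * z ^ (2 * j + 1)) 1) := by
    dsimp only
    rw [hneg, hone]
    exact ⟨hw1.le, hw2.le⟩
  obtain ⟨z, ⟨hz1, hz2⟩, hz⟩ := intermediate_value_Icc (by norm_num) hcont hmem
  dsimp only at hz
  refine ⟨z, (sq_lt_one_iff_abs_lt_one z).2 (abs_lt.2 ⟨lt_of_le_of_ne hz1 ?_, lt_of_le_of_ne hz2 ?_⟩),
    hz⟩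
  · rintro rfl
    rw [hneg] at hz
    linarith
  · rintro rfl
    rw [hone] at hz
    linarith

/-- Derivative of the coordinate `p ↦ p i / √(1 − p_N ²)` of the flattening map at a point with
`x_N ² < 1`: `v ↦ s⁻¹ v i + (x i x_N / s³) v N`, `s = √(1 − x_N ²)`, written in the perspective
normal form `s⁻¹ • proj i − ((−x i x_N / s) / s²) • proj N`. [folklore] -/
theorem oddEven_hasFDerivAt_div {N : ℕ} (x : Fin (N + 1) → ℝ) (i : Fin (N + 1))
    (hx : x (Fin.last N) ^ 2 < 1) :
    HasFDerivAt (fun p : Fin (N + 1) → ℝ => p i / √(1 - p (Fin.last N) ^ 2))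
      ((√(1 - x (Fin.last N) ^ 2))⁻¹ •
          ContinuousLinearMap.proj (R := ℝ) (φ := fun _ : Fin (N + 1) => ℝ) i -
        (-(x i) * x (Fin.last N) / √(1 - x (Fin.last N) ^ 2) / √(1 - x (Fin.last N) ^ 2) ^ 2) •
          ContinuousLinearMap.proj (R := ℝ) (φ := fun _ : Fin (N + 1) => ℝ) (Fin.last N)) x := by
  have hs : 0 < 1 - x (Fin.last N) ^ 2 := by linarith
  have hsq : √(1 - x (Fin.last N) ^ 2) ≠ 0 := Real.sqrt_ne_zero'.2 hs
  have hi : HasFDerivAt (fun p : Fin (N + 1) → ℝ => p i)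
      (ContinuousLinearMap.proj (R := ℝ) (φ := fun _ : Fin (N + 1) => ℝ) i) x := hasFDerivAt_apply i x
  have hl : HasFDerivAt (fun p : Fin (N + 1) → ℝ => p (Fin.last N))
      (ContinuousLinearMap.proj (R := ℝ) (φ := fun _ : Fin (N + 1) => ℝ) (Fin.last N)) x :=
    hasFDerivAt_apply (Fin.last N) x
  have hinv : HasFDerivAt (fun p : Fin (N + 1) → ℝ => (√(1 - p (Fin.last N) ^ 2))⁻¹)
      ((x (Fin.last N) / √(1 - x (Fin.last N) ^ 2) ^ 3) •
        ContinuousLinearMap.proj (R := ℝ) (φ := fun _ : Fin (N + 1) => ℝ) (Fin.last N)) x := by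
    have h := (oddBall_hasDerivAt_invSqrt hx).comp_hasFDerivAt x hl
    exact h
  have hmul := hi.mul hinv
  have hfun : (fun p : Fin (N + 1) → ℝ => p i / √(1 - p (Fin.last N) ^ 2)) =
      (fun p : Fin (N + 1) → ℝ => p i) * fun p : Fin (N + 1) → ℝ =>
        (√(1 - p (Fin.last N) ^ 2))⁻¹ := by
    funext p
    simp [div_eq_mul_inv]
  rw [hfun]
  refine hmul.congr_fderiv ?_
  ext v
  simp only [_root_.add_apply, _root_.smul_apply, _root_.sub_apply,
    ContinuousLinearMap.proj_apply, smul_eq_mul]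
  field_simp
  ring

/-- The move in general even base dimension `N = 2m + 2`, stated with `N` abstract (the
registered stub is the instance `N := 2 * m + 2`). [cite: KontsevichZagier2001, §1.2 rule (2)] -/
theorem oddEven_main {m N : ℕ} (hN : N = 2 * m + 2) (r r' : KZ.IntegralRep (N + 1))
    (hr : r.domain = {p | ∑ i, p i ^ 2 < 1})
    (hr' : r'.domain = {q | ∑ i : Fin N, q (Fin.castSucc i) ^ 2 < 1 ∧
      |q (Fin.last N)| <
        ∑ j ∈ Finset.range (m + 2), (-1 : ℝ) ^ j * (Nat.choose (m + 1) j : ℝ) / (2 * j + 1)})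
    (hf : ∀ p ∈ r.domain, r.integrand p = 1) (hf' : ∀ q ∈ r'.domain, r'.integrand q = 1) :
    KZ.of r - KZ.of r' ∈ KZ.changeOfVariablesRel := by
  -- membership in the two domains, unfolded
  have memr : ∀ p, p ∈ r.domain ↔
      ∑ i : Fin N, p (Fin.castSucc i) ^ 2 + p (Fin.last N) ^ 2 < 1 := fun p => by
    rw [hr, mem_setOf_eq, Fin.sum_univ_castSucc]
  have memr' : ∀ q, q ∈ r'.domain ↔ (∑ i : Fin N, q (Fin.castSucc i) ^ 2 < 1 ∧
      |q (Fin.last N)| <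
        ∑ j ∈ Finset.range (m + 2), (-1 : ℝ) ^ j * (Nat.choose (m + 1) j : ℝ) / (2 * j + 1)) :=
    fun q => by rw [hr']; rfl
  have sum0 : ∀ p : Fin (N + 1) → ℝ, 0 ≤ ∑ i : Fin N, p (Fin.castSucc i) ^ 2 :=
    fun p => Finset.sum_nonneg fun i _ => sq_nonneg _
  -- on the ball the last coordinate lies in `(−1, 1)`
  have ball2 : ∀ p ∈ r.domain, p (Fin.last N) ^ 2 < 1 := fun p hp => by
    linarith [(memr p).1 hp, sum0 p]
  -- the corner entry: `s ^ N = (1 − z²)^(m+1)`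
  have hsN : ∀ z : ℝ, z ^ 2 < 1 → √(1 - z ^ 2) ^ N = (1 - z ^ 2) ^ (m + 1) := fun z hz => by
    rw [hN, show 2 * m + 2 = 2 * (m + 1) by ring, pow_mul, Real.sq_sqrt (by linarith)]
  -- the witness `Φ`, the auxiliary point `aux x = (−x' x_N / s, s)` and the Jacobian `Φ' x`
  let Φ : (Fin (N + 1) → ℝ) → (Fin (N + 1) → ℝ) := fun p =>
    Fin.snoc (α := fun _ : Fin (N + 1) => ℝ)
      (fun i : Fin N => p (Fin.castSucc i) / √(1 - p (Fin.last N) ^ 2))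
      (∑ j ∈ Finset.range (m + 2),
        (-1 : ℝ) ^ j * (Nat.choose (m + 1) j : ℝ) / (2 * j + 1) * p (Fin.last N) ^ (2 * j + 1))
  let aux : (Fin (N + 1) → ℝ) → (Fin (N + 1) → ℝ) := fun x =>
    Fin.snoc (α := fun _ : Fin (N + 1) => ℝ)
      (fun i : Fin N => -(x (Fin.castSucc i)) * x (Fin.last N) / √(1 - x (Fin.last N) ^ 2))
      (√(1 - x (Fin.last N) ^ 2))
  let Φ' : (Fin (N + 1) → ℝ) → (Fin (N + 1) → ℝ) →L[ℝ] (Fin (N + 1) → ℝ) := fun x =>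
    ContinuousLinearMap.pi (Fin.snoc (α := fun _ : Fin (N + 1) => (Fin (N + 1) → ℝ) →L[ℝ] ℝ)
      (fun i : Fin N => (aux x (Fin.last N))⁻¹ •
          ContinuousLinearMap.proj (R := ℝ) (φ := fun _ : Fin (N + 1) => ℝ) (Fin.castSucc i) -
        (aux x (Fin.castSucc i) / aux x (Fin.last N) ^ 2) •
          ContinuousLinearMap.proj (R := ℝ) (φ := fun _ : Fin (N + 1) => ℝ) (Fin.last N))
      (aux x (Fin.last N) ^ N •
        ContinuousLinearMap.proj (R := ℝ) (φ := fun _ : Fin (N + 1) => ℝ) (Fin.last N)))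
  have hΦc : ∀ p (i : Fin N),
      Φ p (Fin.castSucc i) = p (Fin.castSucc i) / √(1 - p (Fin.last N) ^ 2) :=
    fun p i => Fin.snoc_castSucc (α := fun _ : Fin (N + 1) => ℝ) _ _ i
  have hΦl : ∀ p, Φ p (Fin.last N) = ∑ j ∈ Finset.range (m + 2),
      (-1 : ℝ) ^ j * (Nat.choose (m + 1) j : ℝ) / (2 * j + 1) * p (Fin.last N) ^ (2 * j + 1) :=
    fun p => Fin.snoc_last (α := fun _ : Fin (N + 1) => ℝ) _ _
  have hXc : ∀ x (i : Fin N), aux x (Fin.castSucc i) =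
      -(x (Fin.castSucc i)) * x (Fin.last N) / √(1 - x (Fin.last N) ^ 2) :=
    fun x i => Fin.snoc_castSucc (α := fun _ : Fin (N + 1) => ℝ) _ _ i
  have hXl : ∀ x, aux x (Fin.last N) = √(1 - x (Fin.last N) ^ 2) :=
    fun x => Fin.snoc_last (α := fun _ : Fin (N + 1) => ℝ) _ _
  -- the Jacobian determinant is the perspective determinant at the auxiliary point
  have hdet : ∀ x : Fin (N + 1) → ℝ, x (Fin.last N) ^ 2 < 1 → (Φ' x).det = 1 := fun x hx =>
    persp_det_eq_one (aux x) (by rw [hXl]; exact Real.sqrt_ne_zero'.2 (by linarith))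
  -- Φ maps the ball into the cylinder
  have hmaps : ∀ p ∈ r.domain, Φ p ∈ r'.domain := by
    intro p hp
    have hpr := (memr p).1 hp
    have h2 := ball2 p hp
    have hs : 0 < 1 - p (Fin.last N) ^ 2 := by linarith
    rw [memr', hΦl]
    simp only [hΦc]
    refine ⟨?_, oddEven_prim_abs_lt m h2⟩
    simp only [div_pow]
    rw [← Finset.sum_div, Real.sq_sqrt hs.le, div_lt_one hs]
    linarith
  -- Φ is onto the cylinder: explicit inverse `(q' s, z)`, `P z = q_N`, `s = √(1 − z²)`
  have hsurj : ∀ q ∈ r'.domain, ∃ p ∈ r.domain, Φ p = q := by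
    intro q hq
    obtain ⟨hq1, hq2⟩ := (memr' q).1 hq
    obtain ⟨z, hz2, hz⟩ := oddEven_prim_surj m hq2
    have hs : 0 < 1 - z ^ 2 := by linarith
    set s : ℝ := √(1 - z ^ 2) with hs_def
    have hspos : 0 < s := Real.sqrt_pos.2 hs
    have hs2 : s ^ 2 = 1 - z ^ 2 := Real.sq_sqrt hs.le
    refine ⟨Fin.snoc (α := fun _ : Fin (N + 1) => ℝ) (fun i : Fin N => q (Fin.castSucc i) * s) z,
      ?_, ?_⟩
    · rw [memr]
      simp only [Fin.snoc_castSucc, Fin.snoc_last, mul_pow]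
      rw [← Finset.sum_mul]
      nlinarith [mul_lt_mul_of_pos_right hq1 (pow_pos hspos 2)]
    · funext k
      rcases Fin.eq_castSucc_or_eq_last k with ⟨i, rfl⟩ | rfl
      · rw [hΦc]
        simp only [Fin.snoc_castSucc, Fin.snoc_last]
        rw [← hs_def]
        exact mul_div_cancel_right₀ _ hspos.ne'
      · rw [hΦl]
        simp only [Fin.snoc_last]
        exact hz
  refine ⟨N + 1, r, r', Φ, Φ', ?_, ?_, ?_, ?_, ?_, rfl⟩
  · -- `Φ` is `ℚ`-semialgebraic on the ball
    have hsqrt : IsSemialgebraicFunOn ℚ r.domain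
        (fun p : Fin (N + 1) → ℝ => √(1 - p (Fin.last N) ^ 2)) := by
      refine (IsSemialgebraicFunOn.sqrt_holds (isSemialgebraicFunOn_aeval
        r.isSemialgebraic_domain (1 - X (Fin.last N) ^ 2 : MvPolynomial (Fin (N + 1)) ℚ))).congr ?_
      intro p _
      simp
    have hne : ∀ p ∈ r.domain, √(1 - p (Fin.last N) ^ 2) ≠ 0 := fun p hp =>
      Real.sqrt_ne_zero'.2 (by linarith [ball2 p hp])
    refine IsSemialgebraicMapOn.of_forall r.isSemialgebraic_domain fun j => ?_
    rcases Fin.eq_castSucc_or_eq_last j with ⟨i, rfl⟩ | rfl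
    · refine ((isSemialgebraicFunOn_aeval r.isSemialgebraic_domain
        (X (Fin.castSucc i) : MvPolynomial (Fin (N + 1)) ℚ)).div hsqrt hne).congr ?_
      intro p _
      simp only [aeval_X, hΦc]
    · refine (isSemialgebraicFunOn_aeval r.isSemialgebraic_domain
        (∑ j ∈ Finset.range (m + 2), C ((-1 : ℚ) ^ j * (Nat.choose (m + 1) j : ℚ) / (2 * j + 1)) *
          X (Fin.last N) ^ (2 * j + 1) : MvPolynomial (Fin (N + 1)) ℚ)).congr ?_
      intro p _
      simp only [hΦl, map_sum, map_mul, map_pow, aeval_X, aeval_C, eq_ratCast]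
      push_cast
      rfl
  · -- differentiability within the ball
    intro x hx
    have h2 := ball2 x hx
    refine HasFDerivAt.hasFDerivWithinAt (hasFDerivAt_pi'' fun k => ?_)
    rcases Fin.eq_castSucc_or_eq_last k with ⟨i, rfl⟩ | rfl
    · rw [ContinuousLinearMap.proj_pi, Fin.snoc_castSucc, hXl, hXc]
      simp only [hΦc]
      exact oddEven_hasFDerivAt_div x (Fin.castSucc i) h2
    · rw [ContinuousLinearMap.proj_pi, Fin.snoc_last, hXl, hsN _ h2]
      simp only [hΦl]
      have hl : HasFDerivAt (fun p : Fin (N + 1) → ℝ => p (Fin.last N))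
          (ContinuousLinearMap.proj (R := ℝ) (φ := fun _ : Fin (N + 1) => ℝ) (Fin.last N)) x :=
        hasFDerivAt_apply (Fin.last N) x
      exact (oddEven_hasDerivAt_prim m (x (Fin.last N))).comp_hasFDerivAt x hl
  · -- injectivity on the ball
    intro p hp q hq hpq
    have hp2 := ball2 p hp
    have hq2 := ball2 q hq
    have el : Φ p (Fin.last N) = Φ q (Fin.last N) := by rw [hpq]
    rw [hΦl, hΦl] at el
    have hl : p (Fin.last N) = q (Fin.last N) := oddEven_prim_inj m hp2 hq2 el
    have hne : √(1 - q (Fin.last N) ^ 2) ≠ 0 := Real.sqrt_ne_zero'.2 (by linarith)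
    funext k
    rcases Fin.eq_castSucc_or_eq_last k with ⟨i, rfl⟩ | rfl
    · have ec : Φ p (Fin.castSucc i) = Φ q (Fin.castSucc i) := by rw [hpq]
      rw [hΦc, hΦc, hl, div_left_inj' hne] at ec
      exact ec
    · exact hl
  · -- the image is the cylinder
    refine Subset.antisymm (fun q hq => ?_) ?_
    · obtain ⟨p, hp, hpq⟩ := hsurj q hq
      exact ⟨p, hp, hpq⟩
    · rintro _ ⟨p, hp, rfl⟩
      exact hmaps p hp
  · -- the integrands: `1 = 1 · |1|`
    intro x hx
    rw [hf x hx, hf' _ (hmaps x hx), hdet x (ball2 x hx), abs_one, mul_one]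

/-- **Odd balls are cylinders over even balls** (stub `stub_oddBallEven` of the line `Sketch` for
`VolumeForm`, stmt-KontsevichZagierPeriods-3814). For every `m`, with `N = 2m + 2` and
`P z = ∑_{j ≤ m+1} (−1)^j C(m+1, j) z^(2j+1) / (2j+1)`: for representations `r` on the open unit
ball of `ℝ^{N+1}` and `r'` on the cylinder `B^N × (−P 1, P 1)`, both with integrand `1` on their
domains, `[r] − [r']` is one change-of-variables generator of the Kontsevich–Zagier calculus, with
witness `Φ p = (p' / √(1 − p_N ²), P p_N)` (`|det Φ'| = (1 − p_N ²)^(m+1) / √(1 − p_N ²)^N = 1`).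
[cite: KontsevichZagier2001, §1.2 rule (2)] -/
theorem stub_oddBallEven : ∀ (m : ℕ) (r r' : KZ.IntegralRep (2 * m + 2 + 1)),
    r.domain = {p | ∑ i, p i ^ 2 < 1} →
    r'.domain = {q | ∑ i : Fin (2 * m + 2), q (Fin.castSucc i) ^ 2 < 1 ∧
      |q (Fin.last (2 * m + 2))| <
        ∑ j ∈ Finset.range (m + 2), (-1 : ℝ) ^ j * (Nat.choose (m + 1) j : ℝ) / (2 * j + 1)} →
    (∀ p ∈ r.domain, r.integrand p = 1) → (∀ q ∈ r'.domain, r'.integrand q = 1) →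
    KZ.of r - KZ.of r' ∈ KZ.changeOfVariablesRel :=
  fun _ r r' => oddEven_main rfl r r'

end Summit.KontsevichZagierPeriods.SymplecticScissors.VolumeForm

end
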